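import Summits.ABC.IUTFork.Conditional.FreyLegendreSzpiroBadList
import HarnessLib

/-!
# THE RECORDS' SZPIRO-BAD GUARD from one integer inequality — SHARP VARIANT (`π < 3.141593`) for the thin rows

PROOF-ONLY file (D-0012; 0 definitions, 0 `Prop` facts, no instance, no notation) of the abc-iut cell (seat abc-iut-w6-d102, gen 5;
row «C:P6-KERNEL-N3», part 3 supplement). `FreyAdm.szpiroBad_triple` (p493175) bounds `π < 22/7`, which costs `c₂·log(22/(7π)) ≈ 0.003`
nats of margin; three tabulated rows of the R-W table's ANNEX-1 data have TRUE margins ≈ 0.001–0.002 nats ((225008/1996569, 41),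
(122825/6559168, 47), (4826809/9765625, 29)). This file is the same argument with Mathlib's `Real.pi_lt_d6 : π < 3.141593`
(cost `≈ 1.1·10⁻⁷·c₂` nats): `szpiroBad_triple_d6` / `szpiroBad_triple_list_d6`, integer inequality `P₁^A·3141593^B ≤ P₂^C·1000000^B`.

HONEST SCOPE: as in p493175 — OUR records' guard at `(ratPoint (a/c), l)`; elementary real arithmetic; no side taken on [IUTchIII] Cor. 3.12 /
[IUTchIV] Thm. 1.10 or any author; typed ≠ proved; no abc claim.
[cite: Mochizuki2012, IUTchIV Thm. 1.10 p. 22–23] [claim: Mochizuki2012, status: disputed] for every IUT sentence quoted.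
-/

noncomputable section

open scoped Classical

namespace Summit.ABC.IUTFork.Conditional

namespace FreyAdm

open NumberField IsDedekindDomain Literature.IUT.LogVolume Literature.IUT.LogVolume.Cor22
open Literature.NumberTheory.DiophantineGeometry Literature.NumberTheory.DiophantineGeometry.GenEll
open Literature.NumberTheory.DiophantineGeometry.UniformABCConjecture Rat.HeightOneSpectrum

variable {a b c : ℕ} {Il : List ℕ} {e : ℕ → ℕ}

/-- **THE SZPIRO-BAD GUARD at `(ratPoint (a/c), l)` FROM ONE INTEGER INEQUALITY.** For an abc triple with factorisation list
`(abc)² = ∏_{p ∈ Il} p^{e_p}`, a prime `l ≥ 5`, and naturals `A, B, C` (`B, C > 0`) with `6(l²−1)/((l+4)(l−3)) ≤ A/C` and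
`6l(l+5)/((l+4)(l−3)) ≤ B/C`: if `P₁^A·3141593^B ≤ P₂^C·1000000^B` (`P₁ = ∏_{p ∈ Il, p ∉ {2,l}} p`, `P₂ = ∏_{p ∈ Il, p ∉ {2,l}} p^{e_p}`), then the
records' guard holds (right disjunct): `d_mod = 1`, `log-diff = 0`, the dictionary's exact sums, `π < 3.141593` (Mathlib `Real.pi_lt_d6`).
[cite: Mochizuki2012, IUTchIV Thm. 1.10 p. 22–23] [claim: Mochizuki2012, status: disputed] -/
theorem szpiroBad_triple_d6 (h : IsABCTriple a b c) (hI : ∀ p ∈ Il, p.Prime) (hnd : Il.Nodup) (he : ∀ p ∈ Il, e p ≠ 0)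
    (hD : (a * b * c) ^ 2 = (Il.map fun p => p ^ e p).prod) {l : ℕ} (hl : l.Prime) (h5 : 5 ≤ l)
    {A B C : ℕ} (hC : 0 < C) (hB : 0 < B)
    (hA : 6 * ((l : ℚ) ^ 2 - 1) / (((l : ℚ) + 4) * ((l : ℚ) - 3)) ≤ (A : ℚ) / C)
    (hBq : 6 * (l : ℚ) * ((l : ℚ) + 5) / (((l : ℚ) + 4) * ((l : ℚ) - 3)) ≤ (B : ℚ) / C)
    (hineq : (Il.filter (fun p => p ≠ 2 ∧ p ≠ l)).prod ^ A * 3141593 ^ B ≤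
      ((Il.filter (fun p => p ≠ 2 ∧ p ≠ l)).map (fun p => p ^ e p)).prod ^ C * 1000000 ^ B) :
    ((l : ℝ) + 5) / 4 < (Cor22.dmod (ratPoint ((a : ℚ) / c)) : ℝ) ∨
        6 * l * (((l : ℝ) + 5) - 4 * Cor22.dmod (ratPoint ((a : ℚ) / c))) / (((l : ℝ) + 4) * ((l : ℝ) - 3))
            * ((ratPoint ((a : ℚ) / c)).logDiff + (1 - 1 / (l : ℝ)) * Cor22.logCondAvoid (ratPoint ((a : ℚ) / c)) {2, l})
          + 6 * l * ((l : ℝ) + 5) / (((l : ℝ) + 4) * ((l : ℝ) - 3)) * Real.log Real.pi <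
          Cor22.logQAvoid (ratPoint ((a : ℚ) / c)) {2, l} := by
  right
  -- degree-one bookkeeping
  have hdmod : Cor22.dmod (ratPoint ((a : ℚ) / c)) = 1 := dmod_eq_one_of_degree_le_one (degree_ratPoint _).le
  have hdiff : (ratPoint ((a : ℚ) / c)).logDiff = 0 := logDiff_ratPoint _
  -- the dictionary's exact sums
  have hI' : ∀ p ∈ Il.toFinset, p.Prime := fun p hp => hI p (List.mem_toFinset.mp hp)
  have he' : ∀ p ∈ Il.toFinset, e p ≠ 0 := fun p hp => he p (List.mem_toFinset.mp hp)
  have hcop : ∀ p ∈ Il.toFinset, (∀ s ∈ ({2, l} : Finset ℕ), ¬ p ∣ s) → ¬ p ∣ 256 * (c * b + a * a) ^ 3 := by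
    intro p hp hs
    have hp2 : p ≠ 2 := fun h2 => hs 2 (by simp) (by simp [h2])
    exact not_dvd_numerator_of_mem_odd h hI hnd he hD (List.mem_toFinset.mp hp) hp2
  have hLC := logCondAvoid_ratPoint_eq_sum hI' he' (prod_toFinset_eq hnd hD) (jInv_ratPoint_triple h) (numerator_ne_zero h)
    {2, l} hcop
  have hLQ := logQAvoid_ratPoint_eq_sum hI' he' (prod_toFinset_eq hnd hD) (jInv_ratPoint_triple h) (numerator_ne_zero h)
    {2, l} hcop
  set Tl := Il.filter (fun p => p ≠ 2 ∧ p ≠ l) with hTl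
  have hndT : Tl.Nodup := hnd.filter _
  have hTpos : ∀ p ∈ Tl, 0 < p := fun p hp => (hI p (List.mem_filter.mp hp).1).pos
  have hLC' : logCondAvoid (ratPoint ((a : ℚ) / c)) {2, l} = ∑ p ∈ Tl.toFinset, Real.log (p : ℝ) := by
    rw [hLC]
    exact Finset.sum_congr (by ext p; rw [Finset.mem_filter]; exact mem_filter_avoid_iff hI hl p) (fun _ _ => rfl)
  have hLQ' : logQAvoid (ratPoint ((a : ℚ) / c)) {2, l} = ∑ p ∈ Tl.toFinset, (e p : ℝ) * Real.log (p : ℝ) := by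
    rw [hLQ]
    exact Finset.sum_congr (by ext p; rw [Finset.mem_filter]; exact mem_filter_avoid_iff hI hl p) (fun _ _ => rfl)
  -- the two sums as logs of natural numbers
  have hX : ∑ p ∈ Tl.toFinset, Real.log (p : ℝ) = Real.log ((Tl.prod : ℕ) : ℝ) := by
    rw [Nat.cast_list_prod, ← List.prod_toFinset _ hndT, Real.log_prod]
    intro p hp
    exact_mod_cast (hTpos p (List.mem_toFinset.mp hp)).ne'
  have hY : ∑ p ∈ Tl.toFinset, (e p : ℝ) * Real.log (p : ℝ) = Real.log (((Tl.map fun p => p ^ e p).prod : ℕ) : ℝ) := by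
    rw [Nat.cast_list_prod, List.map_map, ← List.prod_toFinset _ hndT, Real.log_prod]
    · refine Finset.sum_congr rfl fun p _ => ?_
      simp only [Function.comp_apply, Nat.cast_pow, Real.log_pow]
    · intro p hp
      simp only [Function.comp_apply, Nat.cast_pow]
      exact pow_ne_zero _ (by exact_mod_cast (hTpos p (List.mem_toFinset.mp hp)).ne')
  rw [hdmod, hdiff, hLC', hLQ', hX, hY]
  -- abbreviations
  set X := Real.log ((Tl.prod : ℕ) : ℝ) with hXdef
  set Y := Real.log (((Tl.map fun p => p ^ e p).prod : ℕ) : ℝ) with hYdef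
  have hP1pos : 0 < Tl.prod := List.prod_pos fun p hp => hTpos p hp
  have hP2pos : 0 < (Tl.map fun p => p ^ e p).prod :=
    List.prod_pos fun x hx => by
      obtain ⟨p, hp, rfl⟩ := List.mem_map.mp hx
      exact pow_pos (hTpos p hp) _
  have hP1r : (0 : ℝ) < ((Tl.prod : ℕ) : ℝ) := by exact_mod_cast hP1pos
  have hP2r : (0 : ℝ) < (((Tl.map fun p => p ^ e p).prod : ℕ) : ℝ) := by exact_mod_cast hP2pos
  have hX0 : 0 ≤ X := Real.log_nonneg (by exact_mod_cast hP1pos)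
  -- π < 3.141593
  have hpi : Real.log Real.pi < Real.log 3141593 - Real.log 1000000 := by
    rw [← Real.log_div (by norm_num) (by norm_num)]
    exact Real.log_lt_log Real.pi_pos (lt_of_lt_of_le Real.pi_lt_d6 (by norm_num))
  have hpi0 : 0 < Real.log Real.pi := Real.log_pos (by linarith [Real.pi_gt_three])
  -- the integer inequality, in logs
  have hmain : (A : ℝ) * X + B * (Real.log 3141593 - Real.log 1000000) ≤ C * Y := by
    have h1 : ((Tl.prod : ℕ) : ℝ) ^ A * (3141593 : ℝ) ^ B ≤ (((Tl.map fun p => p ^ e p).prod : ℕ) : ℝ) ^ C * (1000000 : ℝ) ^ B := by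
      exact_mod_cast hineq
    have h2 := Real.log_le_log (by positivity) h1
    rw [Real.log_mul (by positivity) (by positivity), Real.log_mul (by positivity) (by positivity),
      Real.log_pow, Real.log_pow, Real.log_pow, Real.log_pow] at h2
    linarith
  -- the coefficients
  have hl5 : (5 : ℝ) ≤ l := by exact_mod_cast h5
  have hden : 0 < ((l : ℝ) + 4) * ((l : ℝ) - 3) := by nlinarith
  have hl0 : (l : ℝ) ≠ 0 := by linarith
  have hCr : (0 : ℝ) < C := by exact_mod_cast hC
  have hBr : (0 : ℝ) < B := by exact_mod_cast hB
  have hA' : 6 * ((l : ℝ) ^ 2 - 1) / (((l : ℝ) + 4) * ((l : ℝ) - 3)) ≤ (A : ℝ) / C := by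
    have := (Rat.cast_le (K := ℝ)).mpr hA
    push_cast at this
    exact this
  have hB' : 6 * (l : ℝ) * ((l : ℝ) + 5) / (((l : ℝ) + 4) * ((l : ℝ) - 3)) ≤ (B : ℝ) / C := by
    have := (Rat.cast_le (K := ℝ)).mpr hBq
    push_cast at this
    exact this
  have e1 : 6 * (l : ℝ) * (((l : ℝ) + 5) - 4 * ((1 : ℕ) : ℝ)) / (((l : ℝ) + 4) * ((l : ℝ) - 3)) * (0 + (1 - 1 / (l : ℝ)) * X) =
      (6 * ((l : ℝ) ^ 2 - 1) / (((l : ℝ) + 4) * ((l : ℝ) - 3))) * X := by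
    field_simp
    ring
  have s1 : (6 * ((l : ℝ) ^ 2 - 1) / (((l : ℝ) + 4) * ((l : ℝ) - 3))) * X ≤ (A : ℝ) / C * X :=
    mul_le_mul_of_nonneg_right hA' hX0
  have s2 : 6 * (l : ℝ) * ((l : ℝ) + 5) / (((l : ℝ) + 4) * ((l : ℝ) - 3)) * Real.log Real.pi ≤ (B : ℝ) / C * Real.log Real.pi :=
    mul_le_mul_of_nonneg_right hB' hpi0.le
  have s3 : (B : ℝ) / C * Real.log Real.pi < (B : ℝ) / C * (Real.log 3141593 - Real.log 1000000) :=
    mul_lt_mul_of_pos_left hpi (div_pos hBr hCr)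
  have s4 : (A : ℝ) / C * X + (B : ℝ) / C * (Real.log 3141593 - Real.log 1000000) ≤ Y := by
    rw [div_mul_eq_mul_div, div_mul_eq_mul_div, ← add_div, div_le_iff₀ hCr]
    linarith
  linarith [e1, s1, s2, s3, s4]

/-- **THE SZPIRO-BAD GUARD at `(ratPoint (a/c), l)` for EVERY `l` OF A LIST**, with per-`l` certificate naturals `A l, B l, C l`; the whole
side-condition block (primality, `l ≥ 5`, positivity, the two rational coefficient checks, the integer inequality) is ONE `decide +kernel`
at a datum. [cite: Mochizuki2012, IUTchIV Thm. 1.10 p. 22–23] [claim: Mochizuki2012, status: disputed] -/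
theorem szpiroBad_triple_list_d6 (h : IsABCTriple a b c) (hI : ∀ p ∈ Il, p.Prime) (hnd : Il.Nodup) (he : ∀ p ∈ Il, e p ≠ 0)
    (hD : (a * b * c) ^ 2 = (Il.map fun p => p ^ e p).prod) (A B C : ℕ → ℕ) (L : List ℕ)
    (hside : ∀ l ∈ L, l.Prime ∧ 5 ≤ l ∧ 0 < C l ∧ 0 < B l ∧
      6 * ((l : ℚ) ^ 2 - 1) / (((l : ℚ) + 4) * ((l : ℚ) - 3)) ≤ (A l : ℚ) / C l ∧
      6 * (l : ℚ) * ((l : ℚ) + 5) / (((l : ℚ) + 4) * ((l : ℚ) - 3)) ≤ (B l : ℚ) / C l ∧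
      (Il.filter (fun p => p ≠ 2 ∧ p ≠ l)).prod ^ A l * 3141593 ^ B l ≤
        ((Il.filter (fun p => p ≠ 2 ∧ p ≠ l)).map (fun p => p ^ e p)).prod ^ C l * 1000000 ^ B l) :
    ∀ l ∈ L, ((l : ℝ) + 5) / 4 < (Cor22.dmod (ratPoint ((a : ℚ) / c)) : ℝ) ∨
        6 * l * (((l : ℝ) + 5) - 4 * Cor22.dmod (ratPoint ((a : ℚ) / c))) / (((l : ℝ) + 4) * ((l : ℝ) - 3))
            * ((ratPoint ((a : ℚ) / c)).logDiff + (1 - 1 / (l : ℝ)) * Cor22.logCondAvoid (ratPoint ((a : ℚ) / c)) {2, l})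
          + 6 * l * ((l : ℝ) + 5) / (((l : ℝ) + 4) * ((l : ℝ) - 3)) * Real.log Real.pi <
          Cor22.logQAvoid (ratPoint ((a : ℚ) / c)) {2, l} := by
  intro l hl
  obtain ⟨hlp, h5, hC, hB, hA, hBq, hineq⟩ := hside l hl
  exact szpiroBad_triple_d6 h hI hnd he hD hlp h5 hC hB hA hBq hineq

end FreyAdm

end Summit.ABC.IUTFork.Conditional

end
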